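import Summits.Ventures.Crystal3D.Theorems.StickyWulffConstantGenericWallFloorSlotSum
import HarnessLib

/-!
# The six horizontal slots of `Λ₀` (bridge between the `fccSlots` filter and the riser count's six classes)

HONEST FRAMING. Part of the venture `Summits/Ventures/Crystal3D` (cell `crystal3d-full`), helper
`--supports` the crux `CoaxialWallLaw` (stmt-Ventures-19481, `route-Ventures-StickyWulffConstant`),
REGISTERED line `WallLedgerF` (planner cf-p1 gen 16), stub `stub_coaxialTwoSlabAdhesion`
(terrace/riser slot ledger).  Pure bookkeeping: the absorption inequality
(`twin_absorption_inPlane_moved`, `…CoaxialWallLawTwinAbsorptionMoved`) counts vacant IN-PLANE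
slots as `#{w ∈ fccSlots : w₂ = 0, P w}`, the riser count (`coaxial_inPlane_vacancies`) as six
separate classes `±u, ±v, ±(v − u)` (`u = triangularVec₁ 1`, `v = triangularVec₂ 1`).

* `barlowPos_fcc_layer_zero` — `barlowPos 1 √(2/3) constHagg 0 i j = i•u + j•v`;
* `card_filter_fccSlots_horizontal` — for every decidable predicate `P`,
  `#{w ∈ fccSlots : w₂ = 0 ∧ P w} = [P u] + [P (−u)] + [P v] + [P (−v)] + [P (v−u)] + [P (−(v−u))]`.

WHAT THIS IS NOT: anything about walls; rung F-C1 not moved.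
-/

noncomputable section

namespace Summit.Ventures.Crystal3D.Theorems

open Summit.Ventures.Crystal3D Finset
open Literature.MathematicalPhysics.StatisticalMechanics (barlowPos fccStacking constHagg
  haggLabel_const triangularVec₁ triangularVec₂ barlowPos_apply_two)

/-- Layer `0` of the model fcc stacking is the triangular lattice `ℤu + ℤv`. -/
theorem barlowPos_fcc_layer_zero (i j : ℤ) :
    barlowPos 1 (Real.sqrt (2 / 3)) constHagg 0 i j = (i : ℝ) • triangularVec₁ 1 + (j : ℝ) • triangularVec₂ 1 := by
  simp [barlowPos]

/-- **The horizontal slots are `±u, ±v, ±(v − u)`**, as a counting identity: for every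
decidable predicate `P` on vectors, the number of slots `w` with `w₂ = 0` and `P w` is the sum of
the six indicators `[P u], [P (−u)], [P v], [P (−v)], [P (v − u)], [P (−(v − u))]`. -/
theorem card_filter_fccSlots_horizontal (P : EuclideanSpace ℝ (Fin 3) → Prop) [DecidablePred P] :
    (fccSlots.filter fun w => w 2 = 0 ∧ P w).card =
      (if P (triangularVec₁ 1) then 1 else 0) + (if P (-triangularVec₁ 1) then 1 else 0) +
      (if P (triangularVec₂ 1) then 1 else 0) + (if P (-triangularVec₂ 1) then 1 else 0) +
      (if P (triangularVec₂ 1 - triangularVec₁ 1) then 1 else 0) +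
      (if P (-(triangularVec₂ 1 - triangularVec₁ 1)) then 1 else 0) := by
  classical
  have hH : Real.sqrt (2 / 3) ≠ 0 := (Real.sqrt_pos.2 (by norm_num)).ne'
  -- pull the filter back to the integer triples
  have hinj : Set.InjOn (fun c : ℤ × ℤ × ℤ => barlowPos 1 (Real.sqrt (2 / 3)) constHagg c.1 c.2.1 c.2.2)
      ↑(fccSlotTriples.filter fun c => (barlowPos 1 (Real.sqrt (2 / 3)) constHagg c.1 c.2.1 c.2.2) 2 = 0 ∧
        P (barlowPos 1 (Real.sqrt (2 / 3)) constHagg c.1 c.2.1 c.2.2)) := by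
    intro c _ c' _ h
    have := barlowPos_fcc_injective h
    simp only [Prod.mk.injEq] at this
    exact Prod.ext this.1 (Prod.ext this.2.1 this.2.2)
  rw [fccSlots, filter_image, card_image_of_injOn hinj, card_filter]
  -- the twelve triples, one by one: `w₂ = k·√(2/3)` vanishes iff `k = 0`
  simp only [fccSlotTriples, barlowPos_apply_two]
  rw [sum_insert (by decide), sum_insert (by decide), sum_insert (by decide), sum_insert (by decide),
    sum_insert (by decide), sum_insert (by decide), sum_insert (by decide), sum_insert (by decide),
    sum_insert (by decide), sum_insert (by decide), sum_insert (by decide), sum_singleton]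
  have e1 : barlowPos 1 (Real.sqrt (2 / 3)) constHagg 0 1 0 = triangularVec₁ 1 := by
    rw [barlowPos_fcc_layer_zero]; simp
  have e2 : barlowPos 1 (Real.sqrt (2 / 3)) constHagg 0 0 1 = triangularVec₂ 1 := by
    rw [barlowPos_fcc_layer_zero]; simp
  have e3 : barlowPos 1 (Real.sqrt (2 / 3)) constHagg 0 1 (-1) = -(triangularVec₂ 1 - triangularVec₁ 1) := by
    rw [barlowPos_fcc_layer_zero]; push_cast; module
  have e4 : barlowPos 1 (Real.sqrt (2 / 3)) constHagg 0 (-1) 0 = -triangularVec₁ 1 := by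
    rw [barlowPos_fcc_layer_zero]; push_cast; module
  have e5 : barlowPos 1 (Real.sqrt (2 / 3)) constHagg 0 0 (-1) = -triangularVec₂ 1 := by
    rw [barlowPos_fcc_layer_zero]; push_cast; module
  have e6 : barlowPos 1 (Real.sqrt (2 / 3)) constHagg 0 (-1) 1 = triangularVec₂ 1 - triangularVec₁ 1 := by
    rw [barlowPos_fcc_layer_zero]; push_cast; module
  simp only [e1, e2, e3, e4, e5, e6, Int.cast_zero, Int.cast_one, Int.cast_neg, zero_mul, one_mul,
    neg_mul, neg_eq_zero, hH, true_and, false_and, if_false, add_zero, zero_add]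
  ring

end Summit.Ventures.Crystal3D.Theorems

end
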